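import Literature.AlgebraicGeometry.Frobenioids.Cor54RigidityLinearCocycle
import HarnessLib

/-!
# Frobenioids I, Corollary 5.4 (strong 1-uniqueness at THE data): identity-base linear morphisms with trivial
# unit coordinate are images (sub-DAG row C54-core-arith, sub-row (4), file 4b-III, generic)

Mochizuki, *The geometry of Frobenioids I: the general theory*, Kyushu J. Math. **62** (2008) 293–400,
Corollary 5.4, kurims p. 104 ll. 1–9; model Frobenioids Thm. 5.2 (i) p. 100; Prop. 5.3 p. 103.
[cite: MochizukiFrdI2008, Cor. 5.4 p.104] [cite: MochizukiFrdI2008, Thm. 5.2(i) p.100]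

PROOF-ONLY file (cell abc-iut, seat abc-iut-L1-d8; sub-row (4) of row C54-core-arith; no definitions),
supplement to `Cor54RigidityLinearCocycle.lean` (same setting and notation: `G = h.functor`, `ρ` functorial on
the image homs fixing the `G f`, identity-base linear `k = (1, 𝟙_A, z, u) : G(A, γ) → G(A, γ')`,
`δ(k) = Div(ρ k) - Div(k)`):

* `div_rho_eq_of_unit_one` (c6) — if the unit coordinate of `k` is trivial, relation (d) of Thm. 5.2 (i) puts
  `z` in `η^gp(Φ(A)^gp)`; under SATURATION of `η` at `A` ("an element of `Φ'(A)` whose class lies in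
  `η^gp(Φ(A)^gp)` lies in `η(Φ(A))`" — at `C_{K/F}`: an effective real arithmetic divisor with integral coordinates
  is an effective arithmetic divisor) `k` has the components of the image `G(1, 𝟙_A, w, 0)`, so `Div(ρ k) = z`,
  i.e. `δ(k) = 0`;
* `div_rho_comp_eq_of_unit_mul_eq_one` (c7) — for composable identity-base linear `k₁`, `k₂` with identity-base
  linear images and `u₂ + u₁ = 0`: `ẑ₂ + ẑ₁ = z₂ + z₁`, i.e. `δ(k₂) = -δ(k₁)` ((c1) + (c6)).

Pure model-Frobenioid algebra; nothing here bears on [IUTchIII] Cor. 3.12.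
-/

noncomputable section

namespace Literature.AlgebraicGeometry.Frobenioids

open CategoryTheory Opposite

universe w v u

namespace ModelFrobenioid.DataHom

variable {D : Type u} [Category.{v} D] {Φ B Φ' B' : Dᵒᵖ ⥤ CommMonCat.{w}} {DivB : B ⟶ monoidGp Φ}
  {DivB' : B' ⟶ monoidGp Φ'} (h : DataHom DivB DivB')

/-- **(c6) Trivial unit coordinate forces `δ = 0` (under saturation).** Let `k = (1, 𝟙_A, z, 0) :
G(A, γ) → G(A, γ')` be identity-base linear with trivial unit coordinate. Then `z = η^gp(γ' - γ)` by relation (d);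
if `η` is saturated and `η^gp` injective at `A`, then `z = η(w)`, `γ' = γ + w`, `k` has the components of
`G(1, 𝟙_A, w, 0)`, and `Div(ρ k) = z`. [cite: MochizukiFrdI2008, Cor. 5.4 p.104] -/
theorem div_rho_eq_of_unit_one
    (ρ : ∀ ⦃a a' : ModelFrobenioid Φ B DivB⦄,
      (h.functor.obj a ⟶ h.functor.obj a') → (h.functor.obj a ⟶ h.functor.obj a'))
    (hmap : ∀ ⦃a a' : ModelFrobenioid Φ B DivB⦄ (f : a ⟶ a'), ρ (h.functor.map f) = h.functor.map f)
    (A : D) (hι : Function.Injective (gpApp h.η (op A)))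
    (hsat : ∀ (x : Φ'.obj (op A)) (q : Algebra.GrothendieckGroup (Φ.obj (op A))),
      Algebra.GrothendieckGroup.of x = gpApp h.η (op A) q → ∃ w : Φ.obj (op A), (h.η.app (op A)).hom w = x)
    (γ γ' : Algebra.GrothendieckGroup (Φ.obj (op A))) (k : h.functor.obj ⟨A, γ⟩ ⟶ h.functor.obj ⟨A, γ'⟩)
    (z : Φ'.obj (op A)) (hd : degFr k = 1) (hb : baseMap k = 𝟙 A) (hz : div k = z) (hu : unit k = 1)
    (c : Φ'.obj (op A)) (hc : div (ρ k) = c) : c = z := by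
  -- relation (d): `η^gp(γ) · z = η^gp(γ')`
  have hr := h.rel_linear A γ γ' k hd hb z 1 hz hu
  rw [map_one, mul_one] at hr
  have hzq : Algebra.GrothendieckGroup.of z = gpApp h.η (op A) (γ⁻¹ * γ') := by
    rw [map_mul, map_inv]
    exact eq_inv_mul_of_mul_eq hr
  obtain ⟨w, hw⟩ := hsat z _ hzq
  -- the image pre-step `Z_w = (1, 𝟙_A, w, 0) : (A, γ) → (A, γ + w)` and `γ + w = γ'`
  let Zw : (⟨A, γ⟩ : ModelFrobenioid Φ B DivB) ⟶ ⟨A, γ * Algebra.GrothendieckGroup.of w⟩ :=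
    ⟨1, 𝟙 A, w, 1, by rw [PNat.one_coe, pow_one, map_one, mul_one, pullGp_id]⟩
  have ht : γ * Algebra.GrothendieckGroup.of w = γ' := by
    apply hι
    rw [map_mul, gpApp_of, hw, hr]
  obtain ⟨hGd, hGb, hGz, hGu⟩ := h.rho_map_linear ρ hmap A _ _ Zw rfl rfl
  have h1 : unit (h.functor.map Zw) = 1 := (h.unit_functor_map Zw).trans (map_one _)
  have h2 : div (h.functor.map Zw) = z := (h.div_functor_map Zw).trans hw
  have h3 : div (ρ (h.functor.map Zw)) = z := hGz.trans hw
  exact (h.div_rho_eq_of_cls_eq ρ A γ γ _ _ rfl ht (h.functor.map Zw) k z 1 rfl rfl h2 h1 hd hb hz hu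
    z c h3 hc).symm

/-- **(c7) `δ(k₂) = -δ(k₁)` when the unit coordinates cancel.** For composable identity-base linear
`k₁ = (1, 𝟙, z₁, u₁)`, `k₂ = (1, 𝟙, z₂, u₂)` with identity-base linear images `(1, 𝟙, ẑ_i, û_i)` and
`u₂ · u₁ = 1`: `ẑ₂ · ẑ₁ = z₂ · z₁` in `Φ'(A)` (the composite has trivial unit coordinate; apply (c6)).
[cite: MochizukiFrdI2008, Cor. 5.4 p.104] -/
theorem div_rho_comp_eq_of_unit_mul_eq_one
    (ρ : ∀ ⦃a a' : ModelFrobenioid Φ B DivB⦄,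
      (h.functor.obj a ⟶ h.functor.obj a') → (h.functor.obj a ⟶ h.functor.obj a'))
    (hcomp : ∀ ⦃a a' a'' : ModelFrobenioid Φ B DivB⦄ (k : h.functor.obj a ⟶ h.functor.obj a')
      (l : h.functor.obj a' ⟶ h.functor.obj a''), ρ (k ≫ l) = ρ k ≫ ρ l)
    (hmap : ∀ ⦃a a' : ModelFrobenioid Φ B DivB⦄ (f : a ⟶ a'), ρ (h.functor.map f) = h.functor.map f)
    (A : D) (hι : Function.Injective (gpApp h.η (op A)))
    (hsat : ∀ (x : Φ'.obj (op A)) (q : Algebra.GrothendieckGroup (Φ.obj (op A))),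
      Algebra.GrothendieckGroup.of x = gpApp h.η (op A) q → ∃ w : Φ.obj (op A), (h.η.app (op A)).hom w = x)
    (γ γ' γ'' : Algebra.GrothendieckGroup (Φ.obj (op A)))
    (k₁ : h.functor.obj ⟨A, γ⟩ ⟶ h.functor.obj ⟨A, γ'⟩) (k₂ : h.functor.obj ⟨A, γ'⟩ ⟶ h.functor.obj ⟨A, γ''⟩)
    (z₁ z₂ z₁' z₂' : Φ'.obj (op A)) (u₁ u₂ u₁' u₂' : B'.obj (op A))
    (hd₁ : degFr k₁ = 1) (hb₁ : baseMap k₁ = 𝟙 A) (hz₁ : div k₁ = z₁) (hu₁ : unit k₁ = u₁)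
    (hd₂ : degFr k₂ = 1) (hb₂ : baseMap k₂ = 𝟙 A) (hz₂ : div k₂ = z₂) (hu₂ : unit k₂ = u₂)
    (hρd₁ : degFr (ρ k₁) = 1) (hρb₁ : baseMap (ρ k₁) = 𝟙 A) (hρz₁ : div (ρ k₁) = z₁') (hρu₁ : unit (ρ k₁) = u₁')
    (hρd₂ : degFr (ρ k₂) = 1) (hρb₂ : baseMap (ρ k₂) = 𝟙 A) (hρz₂ : div (ρ k₂) = z₂') (hρu₂ : unit (ρ k₂) = u₂')
    (h1 : u₂ * u₁ = 1) : z₂' * z₁' = z₂ * z₁ := by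
  obtain ⟨⟨hKd, hKb, hKz, hKu⟩, ⟨-, -, hρKz, -⟩⟩ := h.rho_comp_linear ρ hcomp A γ γ' γ'' k₁ k₂ z₁ z₂ z₁' z₂'
    u₁ u₂ u₁' u₂' hd₁ hb₁ hz₁ hu₁ hd₂ hb₂ hz₂ hu₂ hρd₁ hρb₁ hρz₁ hρu₁ hρd₂ hρb₂ hρz₂ hρu₂
  exact h.div_rho_eq_of_unit_one ρ hmap A hι hsat γ γ'' (k₁ ≫ k₂) (z₂ * z₁) hKd hKb hKz (hKu.trans h1)
    (z₂' * z₁') hρKz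

end ModelFrobenioid.DataHom

end Literature.AlgebraicGeometry.Frobenioids
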